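import Mathlib.Analysis.Complex.Basic
import Mathlib.Analysis.Convex.PathConnected
import Mathlib.Analysis.SpecificLimits.Basic
import Mathlib.Algebra.BigOperators.Fin
import Mathlib.Data.Nat.Choose.Sum
import Mathlib.Data.Nat.Factorial.BigOperators
import Mathlib.Order.Fin.Basic
import Mathlib.Topology.Path
import Literature.Probability.RandomPlanarGeometry.Curve
import Literature.Probability.LatticeModels.LatticeInterface
import HarnessLib

/-!
# Signature coefficients (iterated integrals) of planar curves

For a planar curve `γ : Curve ℂ` and a word `w = [w₁, …, wₘ]` in the two letters `0 ↦ d(Re γ)`,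
`1 ↦ d(Im γ)`, the *signature coefficient*
`S_w(γ) = ∫_{0 < t₁ < ⋯ < tₘ < 1} dγ^{w₁}_{t₁} ⋯ dγ^{wₘ}_{tₘ}`
is the coefficient of `e_{w₁} ⊗ ⋯ ⊗ e_{wₘ}` in the signature of `γ` (Chen 1957; Friz–Victoir 2010,
Def. 7.2). Here it is DEFINED as the limit `n → ∞` (junk value if the limit does not exist) of
the dyadic iterated Riemann–Stieltjes sums
`Σ_{0 ≤ k₁ < ⋯ < kₘ < 2ⁿ} Π_j (coordinate w_j of γ((k_j+1)/2ⁿ) − γ(k_j/2ⁿ))`,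
which is *verbatim* the inline abbreviation `sig` of the route
`Summits/CriticalPhenomena/SAWScalingLimit/Theses/SAWExpectedSignature.lean`
(`Curve.signatureCoeff_eq_inline` is `rfl`).

## Contents

* `Curve.coord`, `Curve.dyadicIncr`, `Curve.incrSigFn`/`Curve.incrSig` (the iterated-sums signature
  of a finite sequence of increments, Diehl–Ebrahimi-Fard–Tapia 2020), `Curve.dyadicIterSum`,
  `Curve.signatureCoeff`.
* `Curve.iterSum`: the same iterated sums by recursion on the list of increments
  (deletion/contraction of the first increment) and the bridge `Curve.incrSig_eq_iterSum`.
* the discrete Chen identity `Curve.iterSum_append` (deconcatenation coproduct), the closed form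
  `Curve.iterSum_replicate` for equal increments (binomial coefficient), level `0` and level `1`
  (`Curve.signatureCoeff_nil`, `Curve.signatureCoeff_singleton`: the increment, for every curve),
  translation invariance, constant curves.
* dyadic increments of `Path.refl`, `Path.segment`, `Path.trans` (Mathlib's concatenation puts the
  pieces on `[0,1/2]` and `[1/2,1]`, so the level-`(n+1)` increments of `p.trans q` are the
  level-`n` increments of `p` followed by those of `q`), the discrete Chen identity for
  `Path.trans` and its limit form `Curve.signatureCoeff_trans`, the limit `C(2ⁿ,m)/2ⁿᵐ → 1/m!`,
  and the main theorem `Curve.tendsto_dyadicIterSum_polyline`: for the polyline through a list of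
  points (`Literature.Probability.LatticeModels.polyline`, hence for `SimpleGraph.Walk.toCurve`)
  the dyadic sums CONVERGE and the signature coefficient is the finite tensor-exponential formula
  `Curve.polylineSig` (`= e^{Δ₁} ⊗ ⋯ ⊗ e^{Δ_N}`; Friz–Victoir 2010, Example 7.21, Theorem 7.11
  and §7.4).

## Not here (deliberately)

Existence of the limit for curves of finite `p`-variation, `p < 2` (Young 1936 / Lyons 1998
extension theorem), invariance under reparametrisation, the shuffle identity and the extension
estimate `|S_w| ≤ C V_p^{m/p}/(m/p)!` are NOT proved in this file; they concern the analytic theory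
(Friz–Victoir 2010, Ch. 6 and 9) and are the subject of follow-up files. Nothing here is stated as
an unproved fact.
-/

open Filter Finset
open scoped Topology BigOperators

namespace Literature.Probability.RandomPlanarGeometry

namespace Curve

/-! ### Coordinates and dyadic increments -/

/-- The `i`-th real coordinate functional on `ℂ ≅ ℝ²`: letter `0` is the real part, letter `1` the
imaginary part (the two letters `dx`, `dy` of planar signatures; Friz–Victoir 2010, §7.2). [cite: FrizVictoir2010, Def 7.2] -/
def coord (i : Fin 2) : ℂ → ℝ := if i = 0 then Complex.re else Complex.im

/-- Letter `0` is the real part. [cite: FrizVictoir2010, Def 7.2] -/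
@[simp] lemma coord_zero : coord 0 = Complex.re := rfl

/-- Letter `1` is the imaginary part. [cite: FrizVictoir2010, Def 7.2] -/
@[simp] lemma coord_one : coord 1 = Complex.im := rfl

/-- Each coordinate functional is additive. [folklore] -/
lemma coord_add (i : Fin 2) (z z' : ℂ) : coord i (z + z') = coord i z + coord i z' := by
  fin_cases i <;> simp

/-- Each coordinate functional commutes with subtraction. [folklore] -/
lemma coord_sub (i : Fin 2) (z z' : ℂ) : coord i (z - z') = coord i z - coord i z' := by
  fin_cases i <;> simp

/-- Each coordinate functional vanishes at `0`. [folklore] -/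
@[simp] lemma coord_apply_zero (i : Fin 2) : coord i 0 = 0 := by
  fin_cases i <;> simp

/-- Each coordinate functional is real-homogeneous. [folklore] -/
lemma coord_smul (i : Fin 2) (c : ℝ) (z : ℂ) : coord i (c • z) = c * coord i z := by
  fin_cases i <;> simp

/-- Each coordinate functional commutes with finite sums. [folklore] -/
lemma coord_sum {α : Type*} (i : Fin 2) (s : Finset α) (f : α → ℂ) :
    coord i (∑ a ∈ s, f a) = ∑ a ∈ s, coord i (f a) := by
  fin_cases i <;> simp [Complex.re_sum, Complex.im_sum]

/-- The increment of a curve over the `i`-th dyadic interval of level `n`: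
`γ((i+1)/2ⁿ) − γ(i/2ⁿ)` (times are clamped to `[0,1]` by `Set.projIcc`, so the increment is `0`
for `i ≥ 2ⁿ`). Written exactly as in the route's inline `sig`. [cite: FrizVictoir2010, Def 7.2] -/
noncomputable def dyadicIncr (γ : Curve ℂ) (n i : ℕ) : ℂ :=
  γ (Set.projIcc (0 : ℝ) 1 zero_le_one (((i : ℝ) + 1) / 2 ^ n)) -
    γ (Set.projIcc (0 : ℝ) 1 zero_le_one ((i : ℝ) / 2 ^ n))

/-! ### Iterated sums of a finite sequence of increments -/

open scoped Classical in
/-- The iterated-sums signature coefficient of a finite sequence of planar increments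
`Δ : Fin N → ℂ` for a word given as a letter map `ℓ : Fin m → Fin 2`:
`Σ_{k : Fin m → Fin N strictly increasing} Π_j coord (ℓ j) (Δ (k j))`
(Diehl–Ebrahimi-Fard–Tapia 2020, Def. 3.1, the iterated-sums signature `⟨ISS(x), w⟩` for words in
single letters; for increments of a path sampled along a partition these are the iterated
Riemann–Stieltjes sums of Friz–Victoir 2010, Def. 7.2). [cite: DiehlEbrahimifardTapia2020, Def 3.1] -/
noncomputable def incrSigFn {m N : ℕ} (ℓ : Fin m → Fin 2) (Δ : Fin N → ℂ) : ℝ :=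
  ∑ k ∈ (Finset.univ : Finset (Fin m → Fin N)).filter (fun k => StrictMono k),
    ∏ j : Fin m, coord (ℓ j) (Δ (k j))

/-- The iterated-sums signature coefficient of a finite sequence of planar increments for a word
`w : List (Fin 2)` (Diehl–Ebrahimi-Fard–Tapia 2020, Def. 3.1). [cite: DiehlEbrahimifardTapia2020, Def 3.1] -/
noncomputable def incrSig {N : ℕ} (w : List (Fin 2)) (Δ : Fin N → ℂ) : ℝ :=
  incrSigFn w.get Δ

/-- The level-`n` dyadic iterated Riemann–Stieltjes sum of the word `w` along the curve `γ`:
`Σ_{0 ≤ k₁ < ⋯ < kₘ < 2ⁿ} Π_j coord w_j (γ((k_j+1)/2ⁿ) − γ(k_j/2ⁿ))`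
(Friz–Victoir 2010, Def. 7.2, Riemann–Stieltjes approximation of the iterated integral). [cite: FrizVictoir2010, Def 7.2] -/
noncomputable def dyadicIterSum (w : List (Fin 2)) (γ : Curve ℂ) (n : ℕ) : ℝ :=
  incrSig w (fun i : Fin (2 ^ n) => dyadicIncr γ n i)

/-- The **signature coefficient** `S_w(γ) = ∫_{0<t₁<⋯<tₘ<1} dγ^{w₁}_{t₁} ⋯ dγ^{wₘ}_{tₘ}` of a planar
curve for the word `w` (letters `0 ↦ d Re γ`, `1 ↦ d Im γ`), i.e. the coefficient of
`e_{w₁} ⊗ ⋯ ⊗ e_{wₘ}` of the signature of `γ` over `[0,1]` (Chen 1957; Friz–Victoir 2010, Def. 7.2),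
DEFINED as the limit of the dyadic iterated Riemann–Stieltjes sums `dyadicIterSum w γ n` as
`n → ∞` (`limUnder atTop`; junk value when the limit does not exist). For polylines the limit
exists and is the classical iterated integral (`tendsto_dyadicIterSum_polyline`); `S_[] = 1` and
`S_[i] = coord i (γ 1 − γ 0)` for every curve. [cite: FrizVictoir2010, Def 7.2] -/
noncomputable def signatureCoeff (w : List (Fin 2)) (γ : Curve ℂ) : ℝ :=
  limUnder atTop (dyadicIterSum w γ)

open scoped Classical in
/-- `Curve.signatureCoeff` is, by `rfl`, the inline abbreviation `sig` of the route
`SAWExpectedSignature` (items `MomentsIdentifySLE`, `SigMomentsConverge`, `MomentsPassToLimit`). [cite: FrizVictoir2010, Def 7.2] -/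
theorem signatureCoeff_eq_inline (w : List (Fin 2)) (γ : Curve ℂ) :
    signatureCoeff w γ =
      limUnder Filter.atTop (fun n : ℕ => ∑ k ∈ (Finset.univ : Finset (Fin w.length →
        Fin (2 ^ n))).filter (fun k => StrictMono k), ∏ j : Fin w.length,
          (if w.get j = 0 then Complex.re else Complex.im)
            (γ (Set.projIcc (0 : ℝ) 1 zero_le_one ((((k j : ℕ) : ℝ) + 1) / 2 ^ n)) -
              γ (Set.projIcc (0 : ℝ) 1 zero_le_one (((k j : ℕ) : ℝ) / 2 ^ n)))) :=
  rfl

/-- Unfolding `signatureCoeff`. [cite: FrizVictoir2010, Def 7.2] -/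
lemma signatureCoeff_def (w : List (Fin 2)) (γ : Curve ℂ) :
    signatureCoeff w γ = limUnder atTop (dyadicIterSum w γ) := rfl

/-- Unfolding `dyadicIterSum`. [cite: FrizVictoir2010, Def 7.2] -/
lemma dyadicIterSum_def (w : List (Fin 2)) (γ : Curve ℂ) (n : ℕ) :
    dyadicIterSum w γ n = incrSig w (fun i : Fin (2 ^ n) => dyadicIncr γ n i) := rfl

/-- Unfolding `incrSig`. [cite: DiehlEbrahimifardTapia2020, Def 3.1] -/
lemma incrSig_def {N : ℕ} (w : List (Fin 2)) (Δ : Fin N → ℂ) :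
    incrSig w Δ = incrSigFn w.get Δ := rfl

/-- If the dyadic iterated sums converge to `L`, the signature coefficient is `L`. [cite: FrizVictoir2010, Def 7.2] -/
theorem signatureCoeff_eq_of_tendsto {w : List (Fin 2)} {γ : Curve ℂ} {L : ℝ}
    (h : Tendsto (dyadicIterSum w γ) atTop (𝓝 L)) : signatureCoeff w γ = L :=
  h.limUnder_eq

/-! ### The recursion on the number of increments -/

/-- With no letters the iterated sum is `1` (one empty product). [cite: DiehlEbrahimifardTapia2020, Def 3.1] -/
theorem incrSigFn_zero_left {N : ℕ} (ℓ : Fin 0 → Fin 2) (Δ : Fin N → ℂ) : incrSigFn ℓ Δ = 1 := by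
  unfold incrSigFn
  have h : ((Finset.univ : Finset (Fin 0 → Fin N)).filter fun k => StrictMono k) = Finset.univ :=
    Finset.filter_true_of_mem fun k _ a => a.elim0
  rw [h]
  simp

/-- With at least one letter and no increments the iterated sum is `0` (empty sum). [cite: DiehlEbrahimifardTapia2020, Def 3.1] -/
theorem incrSigFn_succ_zero {m : ℕ} (ℓ : Fin (m + 1) → Fin 2) (Δ : Fin 0 → ℂ) :
    incrSigFn ℓ Δ = 0 := by
  unfold incrSigFn
  have h : ((Finset.univ : Finset (Fin (m + 1) → Fin 0)).filter fun k => StrictMono k) = ∅ := by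
    ext k
    exact (k 0).elim0
  rw [h, Finset.sum_empty]

/-- Prepending `0` to the successors of a strictly increasing tuple gives a strictly increasing
tuple. [folklore] -/
lemma strictMono_cons_zero_succ {m N : ℕ} {k : Fin m → Fin N} (hk : StrictMono k) :
    StrictMono (Fin.cons (0 : Fin (N + 1)) (fun j => (k j).succ) : Fin (m + 1) → Fin (N + 1)) := by
  intro a b
  refine Fin.cases ?_ (fun a => ?_) a <;> refine Fin.cases ?_ (fun b => ?_) b <;> intro hab
  · exact absurd hab (lt_irrefl _)
  · simp only [Fin.cons_zero, Fin.cons_succ]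
    exact Fin.succ_pos _
  · exact absurd hab (Fin.not_lt_zero _)
  · simp only [Fin.cons_succ]
    exact Fin.succ_lt_succ_iff.2 (hk (Fin.succ_lt_succ_iff.1 hab))

/-- **Deletion/contraction recursion** of iterated sums in the first increment: a strictly
increasing placement of the `m+1` letters among `N+1` increments either puts the first letter on
the first increment (and the remaining letters strictly later) or avoids the first increment
altogether. [cite: DiehlEbrahimifardTapia2020, Def 3.1] -/
theorem incrSigFn_succ_succ {m N : ℕ} (ℓ : Fin (m + 1) → Fin 2) (Δ : Fin (N + 1) → ℂ) :
    incrSigFn ℓ Δ =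
      coord (ℓ 0) (Δ 0) * incrSigFn (Fin.tail ℓ) (Fin.tail Δ) + incrSigFn ℓ (Fin.tail Δ) := by
  unfold incrSigFn
  rw [← Finset.sum_filter_add_sum_filter_not _ (fun k : Fin (m + 1) → Fin (N + 1) => k 0 = 0)]
  congr 1
  · -- placements using the first increment for the first letter
    rw [Finset.mul_sum]
    symm
    refine Finset.sum_nbij (fun k => (Fin.cons (0 : Fin (N + 1)) (fun j => (k j).succ) :
      Fin (m + 1) → Fin (N + 1))) ?_ ?_ ?_ ?_
    · intro k hk
      simp only [Finset.mem_filter, Finset.mem_univ, true_and] at hk ⊢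
      exact ⟨strictMono_cons_zero_succ hk, by simp⟩
    · intro k₁ _ k₂ _ h
      funext j
      have hj := congrFun h j.succ
      simp only [Fin.cons_succ] at hj
      exact Fin.succ_injective _ hj
    · intro k hk
      simp only [Finset.mem_coe, Finset.mem_filter, Finset.mem_univ, true_and] at hk
      obtain ⟨hk, hk0⟩ := hk
      have hne : ∀ j : Fin m, k j.succ ≠ 0 := by
        intro j hj
        have h := hk (Fin.succ_pos j)
        rw [hj, hk0] at h
        exact lt_irrefl _ h
      refine ⟨fun j => (k j.succ).pred (hne j), ?_, ?_⟩
      · simp only [Finset.mem_coe, Finset.mem_filter, Finset.mem_univ, true_and]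
        exact Fin.strictMono_pred_comp hne (hk.comp (Fin.strictMono_succ))
      · funext j
        refine Fin.cases ?_ (fun j => ?_) j
        · simp [hk0]
        · simp
    · intro k _
      rw [Fin.prod_univ_succ]
      simp only [Fin.cons_zero, Fin.cons_succ]
      rfl
  · -- placements avoiding the first increment
    symm
    refine Finset.sum_nbij (fun k j => (k j).succ) ?_ ?_ ?_ ?_
    · intro k hk
      simp only [Finset.mem_filter, Finset.mem_univ, true_and] at hk ⊢
      exact ⟨Fin.strictMono_succ.comp hk, Fin.succ_ne_zero _⟩
    · intro k₁ _ k₂ _ h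
      funext j
      exact Fin.succ_injective _ (congrFun h j)
    · intro k hk
      simp only [Finset.mem_coe, Finset.mem_filter, Finset.mem_univ, true_and] at hk
      obtain ⟨hk, hk0⟩ := hk
      have hne : ∀ j : Fin (m + 1), k j ≠ 0 := by
        intro j hj
        have h := hk.monotone (Fin.zero_le j)
        rw [hj] at h
        exact hk0 (le_antisymm h (Fin.zero_le _))
      refine ⟨fun j => (k j).pred (hne j), ?_, ?_⟩
      · simp only [Finset.mem_coe, Finset.mem_filter, Finset.mem_univ, true_and]
        exact Fin.strictMono_pred_comp hne hk
      · funext j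
        simp
    · intro k _
      rfl

/-- The iterated sums of a LIST of planar increments for a word `w`, by recursion on the list
(deletion/contraction of the first increment): `iterSum [] xs = 1`, `iterSum (a :: w) [] = 0`,
`iterSum (a :: w) (x :: xs) = coord a x * iterSum w xs + iterSum (a :: w) xs`. Equals the
explicit sum over strictly increasing placements (`incrSig_eq_iterSum`);
Diehl–Ebrahimi-Fard–Tapia 2020, Def. 3.1 (iterated-sums signature). [cite: DiehlEbrahimifardTapia2020, Def 3.1] -/
noncomputable def iterSum : List (Fin 2) → List ℂ → ℝ
  | [], _ => 1
  | _ :: _, [] => 0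
  | a :: w, x :: xs => coord a x * iterSum w xs + iterSum (a :: w) xs

/-- The empty word has iterated sum `1`. [cite: DiehlEbrahimifardTapia2020, Def 3.1] -/
@[simp] lemma iterSum_nil_left (xs : List ℂ) : iterSum [] xs = 1 := by
  cases xs <;> rfl

/-- A nonempty word has iterated sum `0` over no increments. [cite: DiehlEbrahimifardTapia2020, Def 3.1] -/
@[simp] lemma iterSum_cons_nil (a : Fin 2) (w : List (Fin 2)) : iterSum (a :: w) [] = 0 := rfl

/-- The deletion/contraction recursion of iterated sums. [cite: DiehlEbrahimifardTapia2020, Def 3.1] -/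
@[simp] lemma iterSum_cons_cons (a : Fin 2) (w : List (Fin 2)) (x : ℂ) (xs : List ℂ) :
    iterSum (a :: w) (x :: xs) = coord a x * iterSum w xs + iterSum (a :: w) xs := rfl

/-- Over no increments the iterated sum is `1` for the empty word and `0` otherwise. [cite: DiehlEbrahimifardTapia2020, Def 3.1] -/
lemma iterSum_nil_right (w : List (Fin 2)) : iterSum w [] = if w = [] then 1 else 0 := by
  cases w <;> simp

/-- If all increments vanish, only the empty word survives. [cite: DiehlEbrahimifardTapia2020, Def 3.1] -/
lemma iterSum_replicate_zero (w : List (Fin 2)) (N : ℕ) :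
    iterSum w (List.replicate N 0) = if w = [] then 1 else 0 := by
  induction N generalizing w with
  | zero => simpa using iterSum_nil_right w
  | succ N ih => cases w <;> simp [List.replicate_succ, ih]

/-- **Bridge**: the explicit iterated sum over strictly increasing placements equals the recursive
`iterSum` of the lists of letters and increments. [cite: DiehlEbrahimifardTapia2020, Def 3.1] -/
theorem incrSigFn_eq_iterSum :
    ∀ {m N : ℕ} (ℓ : Fin m → Fin 2) (Δ : Fin N → ℂ),
      incrSigFn ℓ Δ = iterSum (List.ofFn ℓ) (List.ofFn Δ)
  | 0, _, ℓ, Δ => by rw [incrSigFn_zero_left, List.ofFn_zero, iterSum_nil_left]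
  | m + 1, 0, ℓ, Δ => by
      rw [incrSigFn_succ_zero, List.ofFn_zero, List.ofFn_succ (f := ℓ), iterSum_cons_nil]
  | m + 1, N + 1, ℓ, Δ => by
      rw [incrSigFn_succ_succ, incrSigFn_eq_iterSum (Fin.tail ℓ) (Fin.tail Δ),
        incrSigFn_eq_iterSum ℓ (Fin.tail Δ), List.ofFn_succ (f := ℓ), List.ofFn_succ (f := Δ),
        iterSum_cons_cons]
      rfl

/-- **Bridge** for words as lists: `incrSig w Δ = iterSum w (List.ofFn Δ)`. [cite: DiehlEbrahimifardTapia2020, Def 3.1] -/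
theorem incrSig_eq_iterSum {N : ℕ} (w : List (Fin 2)) (Δ : Fin N → ℂ) :
    incrSig w Δ = iterSum w (List.ofFn Δ) := by
  rw [incrSig_def, incrSigFn_eq_iterSum, List.ofFn_get]

/-- The list of level-`n` dyadic increments of a curve. [cite: FrizVictoir2010, Def 7.2] -/
noncomputable def dyadicIncrList (γ : Curve ℂ) (n : ℕ) : List ℂ :=
  List.ofFn fun i : Fin (2 ^ n) => dyadicIncr γ n i

/-- The list of level-`n` dyadic increments has length `2ⁿ`. [cite: FrizVictoir2010, Def 7.2] -/
@[simp] lemma length_dyadicIncrList (γ : Curve ℂ) (n : ℕ) : (dyadicIncrList γ n).length = 2 ^ n := by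
  simp [dyadicIncrList]

/-- The dyadic iterated sum is the recursive iterated sum of the list of dyadic increments. [cite: FrizVictoir2010, Def 7.2] -/
theorem dyadicIterSum_eq_iterSum (w : List (Fin 2)) (γ : Curve ℂ) (n : ℕ) :
    dyadicIterSum w γ n = iterSum w (dyadicIncrList γ n) :=
  incrSig_eq_iterSum w _

/-! ### Chen's identity and closed forms for lists of increments -/

/-- **Discrete Chen identity** (deconcatenation): the iterated sums of a concatenated sequence of
increments are the convolution of those of the pieces over all splittings `w = w.take i ++ w.drop i`
of the word (Chen 1957; Friz–Victoir 2010, Thm 7.11, here in its exact finite form for Riemann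
sums; Diehl–Ebrahimi-Fard–Tapia 2020, Chen's identity for iterated-sums signatures). [cite: FrizVictoir2010, Thm 7.11] -/
theorem iterSum_append (w : List (Fin 2)) (xs ys : List ℂ) :
    iterSum w (xs ++ ys) =
      ∑ i ∈ Finset.range (w.length + 1), iterSum (w.take i) xs * iterSum (w.drop i) ys := by
  induction xs generalizing w with
  | nil =>
    cases w with
    | nil => simp
    | cons a w =>
      rw [List.nil_append, Finset.sum_range_succ']
      simp
  | cons x xs ih =>
    cases w with
    | nil => simp
    | cons a w =>
      rw [List.cons_append, iterSum_cons_cons, ih w, ih (a :: w)]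
      rw [Finset.sum_range_succ' (fun i => iterSum ((a :: w).take i) (x :: xs) * _)]
      rw [Finset.sum_range_succ' (fun i => iterSum ((a :: w).take i) xs * _)]
      simp only [List.take_zero, List.drop_zero, iterSum_nil_left, one_mul, List.take_succ_cons,
        List.drop_succ_cons, iterSum_cons_cons, List.length_cons, add_mul, Finset.sum_add_distrib,
        Finset.mul_sum, mul_assoc]
      ring

/-- Iterated sums of `N` EQUAL increments `x`: `C(N, |w|) Π_j coord w_j x` (the level-`|w|`
coefficient of `(1 + x)^{⊗N}`; for `x = v/N` this tends to the tensor exponential, Friz–Victoir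
2010, Example 7.21). [cite: FrizVictoir2010, Example 7.21] -/
theorem iterSum_replicate (w : List (Fin 2)) (N : ℕ) (x : ℂ) :
    iterSum w (List.replicate N x) = (N.choose w.length : ℝ) * (w.map fun a => coord a x).prod := by
  induction N generalizing w with
  | zero =>
    cases w with
    | nil => simp
    | cons a w => simp
  | succ N ih =>
    cases w with
    | nil => simp
    | cons a w =>
      rw [List.replicate_succ, iterSum_cons_cons, ih w, ih (a :: w), List.length_cons,
        Nat.choose_succ_succ, Nat.cast_add, List.map_cons, List.prod_cons]
      ring

/-! ### Level zero, level one, translation invariance, constant curves -/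

/-- The level-`0` dyadic sums are all `1`. [cite: FrizVictoir2010, Def 7.2] -/
@[simp] theorem dyadicIterSum_nil (γ : Curve ℂ) (n : ℕ) : dyadicIterSum [] γ n = 1 := by
  rw [dyadicIterSum_eq_iterSum, iterSum_nil_left]

/-- `S_[](γ) = 1` for every curve (Friz–Victoir 2010, Def. 7.2: the level-`0` component of the
signature is `1`). [cite: FrizVictoir2010, Def 7.2] -/
@[simp] theorem signatureCoeff_nil (γ : Curve ℂ) : signatureCoeff [] γ = 1 := by
  refine signatureCoeff_eq_of_tendsto ?_
  have h : dyadicIterSum [] γ = fun _ => 1 := funext (dyadicIterSum_nil γ)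
  rw [h]
  exact tendsto_const_nhds

/-- A one-letter iterated sum is the coordinate of the total increment. [cite: DiehlEbrahimifardTapia2020, Def 3.1] -/
theorem iterSum_singleton (a : Fin 2) (xs : List ℂ) : iterSum [a] xs = coord a xs.sum := by
  induction xs with
  | nil => simp
  | cons x xs ih => rw [iterSum_cons_cons, iterSum_nil_left, ih, List.sum_cons, coord_add, mul_one]

/-- The dyadic increments of level `n` telescope to `γ 1 − γ 0`. [folklore] -/
theorem sum_dyadicIncr (γ : Curve ℂ) (n : ℕ) :
    ∑ i : Fin (2 ^ n), dyadicIncr γ n i = γ 1 - γ 0 := by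
  have h2 : (0 : ℝ) < 2 ^ n := by positivity
  rw [Fin.sum_univ_eq_sum_range (fun i => dyadicIncr γ n i) (2 ^ n)]
  have key : ∀ i : ℕ, dyadicIncr γ n i =
      γ (Set.projIcc (0 : ℝ) 1 zero_le_one (((i + 1 : ℕ) : ℝ) / 2 ^ n)) -
        γ (Set.projIcc (0 : ℝ) 1 zero_le_one ((i : ℝ) / 2 ^ n)) := by
    intro i
    simp [dyadicIncr]
  simp_rw [key]
  rw [Finset.sum_range_sub (fun i : ℕ => γ (Set.projIcc (0 : ℝ) 1 zero_le_one ((i : ℝ) / 2 ^ n)))]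
  have h1 : Set.projIcc (0 : ℝ) 1 zero_le_one (((2 ^ n : ℕ) : ℝ) / 2 ^ n) = 1 := by
    rw [Nat.cast_pow, Nat.cast_ofNat, div_self h2.ne', Set.projIcc_right]
    rfl
  have h0 : Set.projIcc (0 : ℝ) 1 zero_le_one (((0 : ℕ) : ℝ) / 2 ^ n) = 0 := by
    rw [Nat.cast_zero, zero_div, Set.projIcc_left]
    rfl
  rw [h1, h0]

/-- The list of dyadic increments sums to the total increment. [folklore] -/
theorem sum_dyadicIncrList (γ : Curve ℂ) (n : ℕ) : (dyadicIncrList γ n).sum = γ 1 - γ 0 := by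
  rw [dyadicIncrList, List.sum_ofFn, sum_dyadicIncr]

/-- The level-`1` dyadic sums do not depend on the level: they equal the coordinate of the total
increment `γ 1 − γ 0`. [cite: FrizVictoir2010, Def 7.2] -/
theorem dyadicIterSum_singleton (a : Fin 2) (γ : Curve ℂ) (n : ℕ) :
    dyadicIterSum [a] γ n = coord a (γ 1 - γ 0) := by
  rw [dyadicIterSum_eq_iterSum, iterSum_singleton, sum_dyadicIncrList]

/-- `S_[a](γ) = coord a (γ 1 − γ 0)`: the level-`1` signature is the increment, for EVERY curve
(Friz–Victoir 2010, Def. 7.2). [cite: FrizVictoir2010, Def 7.2] -/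
theorem signatureCoeff_singleton (a : Fin 2) (γ : Curve ℂ) :
    signatureCoeff [a] γ = coord a (γ 1 - γ 0) := by
  refine signatureCoeff_eq_of_tendsto ?_
  have h : dyadicIterSum [a] γ = fun _ => coord a (γ 1 - γ 0) :=
    funext (dyadicIterSum_singleton a γ)
  rw [h]
  exact tendsto_const_nhds

/-- Dyadic increments are invariant under translation of the curve. [folklore] -/
lemma dyadicIncr_eq_of_translate {γ γ' : Curve ℂ} {z : ℂ} (h : ∀ t, γ' t = γ t + z) (n i : ℕ) :
    dyadicIncr γ' n i = dyadicIncr γ n i := by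
  simp only [dyadicIncr, h]
  ring

/-- Dyadic iterated sums are invariant under translation of the curve. [cite: FrizVictoir2010, Def 7.2] -/
lemma dyadicIterSum_eq_of_translate {γ γ' : Curve ℂ} {z : ℂ} (h : ∀ t, γ' t = γ t + z)
    (w : List (Fin 2)) : dyadicIterSum w γ' = dyadicIterSum w γ := by
  funext n
  simp only [dyadicIterSum_def, dyadicIncr_eq_of_translate h]

/-- **Translation invariance** of signature coefficients: `S_w(γ + z) = S_w(γ)`
(Friz–Victoir 2010, §7.2: the signature only sees increments). [cite: FrizVictoir2010, Def 7.2] -/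
theorem signatureCoeff_eq_of_translate {γ γ' : Curve ℂ} {z : ℂ} (h : ∀ t, γ' t = γ t + z)
    (w : List (Fin 2)) : signatureCoeff w γ' = signatureCoeff w γ := by
  rw [signatureCoeff_def, signatureCoeff_def, dyadicIterSum_eq_of_translate h]

/-- A constant curve has vanishing dyadic increments. [folklore] -/
@[simp] lemma dyadicIncr_const (c : ℂ) (n i : ℕ) : dyadicIncr (const c) n i = 0 := sub_self _

/-- The dyadic increments of a constant curve are a list of zeros. [folklore] -/
lemma dyadicIncrList_const (c : ℂ) (n : ℕ) :
    dyadicIncrList (const c) n = List.replicate (2 ^ n) 0 := by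
  simp [dyadicIncrList, List.ofFn_const]

/-- The dyadic iterated sums of a constant curve: `1` for the empty word, `0` otherwise. [cite: FrizVictoir2010, Def 7.2] -/
theorem dyadicIterSum_const (w : List (Fin 2)) (c : ℂ) (n : ℕ) :
    dyadicIterSum w (const c) n = if w = [] then 1 else 0 := by
  rw [dyadicIterSum_eq_iterSum, dyadicIncrList_const, iterSum_replicate_zero]

/-- The signature of a constant curve is the unit `(1, 0, 0, …)` (Friz–Victoir 2010, Def. 7.2). [cite: FrizVictoir2010, Def 7.2] -/
theorem signatureCoeff_const (w : List (Fin 2)) (c : ℂ) :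
    signatureCoeff w (const c) = if w = [] then 1 else 0 := by
  refine signatureCoeff_eq_of_tendsto ?_
  have h : dyadicIterSum w (const c) = fun _ => if w = [] then 1 else 0 :=
    funext (dyadicIterSum_const w c)
  rw [h]
  exact tendsto_const_nhds

/-! ### Dyadic increments of concatenations, segments and constant paths -/

section Paths

variable {x y z : ℂ}

/-- Sampling the curve of a path at the clamped real time `s` is `Path.extend`. [folklore] -/
lemma ofPath_apply_projIcc (p : Path x y) (s : ℝ) :
    ofPath p (Set.projIcc 0 1 zero_le_one s) = p.extend s := rfl

/-- Dyadic increments of the curve of a path, via `Path.extend`. [cite: FrizVictoir2010, Def 7.2] -/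
lemma dyadicIncr_ofPath (p : Path x y) (n i : ℕ) :
    dyadicIncr (ofPath p) n i = p.extend (((i : ℝ) + 1) / 2 ^ n) - p.extend ((i : ℝ) / 2 ^ n) :=
  rfl

/-- **Concatenation, first half**: Mathlib's `Path.trans` runs the first path on `[0, 1/2]`, so the
level-`(n+1)` dyadic increments of `p.trans q` with index `i < 2ⁿ` are the level-`n` increments of
`p` (Friz–Victoir 2010, Thm 7.11: concatenation of paths). [cite: FrizVictoir2010, Thm 7.11] -/
lemma dyadicIncr_trans_left (p : Path x y) (q : Path y z) (n i : ℕ) (hi : i < 2 ^ n) :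
    dyadicIncr (ofPath (p.trans q)) (n + 1) i = dyadicIncr (ofPath p) n i := by
  rw [dyadicIncr_ofPath, dyadicIncr_ofPath]
  have h2 : (0 : ℝ) < 2 ^ n := by positivity
  have hi' : (i : ℝ) + 1 ≤ 2 ^ n := by exact_mod_cast Nat.succ_le_of_lt hi
  have hle1 : ((i : ℝ) + 1) / 2 ^ (n + 1) ≤ 1 / 2 := by
    rw [div_le_iff₀ (by positivity), pow_succ]
    linarith
  have hle0 : (i : ℝ) / 2 ^ (n + 1) ≤ 1 / 2 := by
    rw [div_le_iff₀ (by positivity), pow_succ]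
    linarith
  have e1 : 2 * (((i : ℝ) + 1) / 2 ^ (n + 1)) = ((i : ℝ) + 1) / 2 ^ n := by
    rw [pow_succ]
    field_simp
  have e0 : 2 * ((i : ℝ) / 2 ^ (n + 1)) = (i : ℝ) / 2 ^ n := by
    rw [pow_succ]
    field_simp
  rw [Path.extend_trans_of_le_half _ _ hle1, Path.extend_trans_of_le_half _ _ hle0, e1, e0]

/-- **Concatenation, second half**: the level-`(n+1)` dyadic increments of `p.trans q` with index
`2ⁿ + i`, `i < 2ⁿ`, are the level-`n` increments of `q` (Friz–Victoir 2010, Thm 7.11). [cite: FrizVictoir2010, Thm 7.11] -/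
lemma dyadicIncr_trans_right (p : Path x y) (q : Path y z) (n i : ℕ) :
    dyadicIncr (ofPath (p.trans q)) (n + 1) (2 ^ n + i) = dyadicIncr (ofPath q) n i := by
  rw [dyadicIncr_ofPath, dyadicIncr_ofPath]
  have h2 : (0 : ℝ) < 2 ^ n := by positivity
  have hi0 : (0 : ℝ) ≤ i := by positivity
  have hge1 : (1 : ℝ) / 2 ≤ (((2 ^ n + i : ℕ) : ℝ) + 1) / 2 ^ (n + 1) := by
    rw [le_div_iff₀ (by positivity), pow_succ]
    push_cast
    linarith
  have hge0 : (1 : ℝ) / 2 ≤ ((2 ^ n + i : ℕ) : ℝ) / 2 ^ (n + 1) := by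
    rw [le_div_iff₀ (by positivity), pow_succ]
    push_cast
    linarith
  have e1 : 2 * ((((2 ^ n + i : ℕ) : ℝ) + 1) / 2 ^ (n + 1)) - 1 = ((i : ℝ) + 1) / 2 ^ n := by
    push_cast
    rw [pow_succ]
    field_simp
    ring
  have e0 : 2 * (((2 ^ n + i : ℕ) : ℝ) / 2 ^ (n + 1)) - 1 = (i : ℝ) / 2 ^ n := by
    push_cast
    rw [pow_succ]
    field_simp
    ring
  rw [Path.extend_trans_of_half_le _ _ hge1, Path.extend_trans_of_half_le _ _ hge0, e1, e0]

/-- The level-`(n+1)` dyadic increments of a concatenation are the level-`n` increments of the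
first path followed by those of the second (exact, because `Path.trans` splits `[0,1]` at `1/2`). [cite: FrizVictoir2010, Thm 7.11] -/
theorem dyadicIncrList_trans (p : Path x y) (q : Path y z) (n : ℕ) :
    dyadicIncrList (ofPath (p.trans q)) (n + 1) =
      dyadicIncrList (ofPath p) n ++ dyadicIncrList (ofPath q) n := by
  have hp : 2 ^ (n + 1) = 2 ^ n + 2 ^ n := by rw [pow_succ]; ring
  apply List.ext_getElem
  · simp [hp]
  · intro i h₁ h₂
    rw [length_dyadicIncrList] at h₁
    simp only [dyadicIncrList, List.getElem_ofFn, List.getElem_append, List.length_ofFn]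
    split_ifs with h
    · exact dyadicIncr_trans_left p q n i h
    · obtain ⟨j, rfl⟩ : ∃ j, i = 2 ^ n + j := ⟨i - 2 ^ n, by omega⟩
      rw [Nat.add_sub_cancel_left]
      exact dyadicIncr_trans_right p q n j

/-- **Discrete Chen identity for `Path.trans`**: the level-`(n+1)` dyadic iterated sums of a
concatenation are the deconcatenation-convolution of the level-`n` sums of the two pieces
(Chen 1957; Friz–Victoir 2010, Thm 7.11, exact at the level of Riemann sums). [cite: FrizVictoir2010, Thm 7.11] -/
theorem dyadicIterSum_trans_succ (p : Path x y) (q : Path y z) (w : List (Fin 2)) (n : ℕ) :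
    dyadicIterSum w (ofPath (p.trans q)) (n + 1) =
      ∑ i ∈ Finset.range (w.length + 1),
        dyadicIterSum (w.take i) (ofPath p) n * dyadicIterSum (w.drop i) (ofPath q) n := by
  simp only [dyadicIterSum_eq_iterSum, dyadicIncrList_trans, iterSum_append]

/-- **Chen's identity** `S(p ∗ q) = S(p) ⊗ S(q)` in coordinates: if the dyadic iterated sums of the
pieces converge (for the relevant sub-words), those of the concatenation converge to
`Σ_{w = u ++ v} S_u(p) S_v(q)` (Chen 1957; Friz–Victoir 2010, Thm 7.11). [cite: FrizVictoir2010, Thm 7.11] -/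
theorem tendsto_dyadicIterSum_trans {p : Path x y} {q : Path y z} {w : List (Fin 2)}
    (hp : ∀ i ≤ w.length, ∃ L, Tendsto (dyadicIterSum (w.take i) (ofPath p)) atTop (𝓝 L))
    (hq : ∀ i ≤ w.length, ∃ L, Tendsto (dyadicIterSum (w.drop i) (ofPath q)) atTop (𝓝 L)) :
    Tendsto (dyadicIterSum w (ofPath (p.trans q))) atTop
      (𝓝 (∑ i ∈ Finset.range (w.length + 1),
        signatureCoeff (w.take i) (ofPath p) * signatureCoeff (w.drop i) (ofPath q))) := by
  rw [← tendsto_add_atTop_iff_nat 1]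
  simp only [dyadicIterSum_trans_succ]
  refine tendsto_finsetSum _ fun i hi => ?_
  have hi' : i ≤ w.length := Nat.lt_succ_iff.1 (Finset.mem_range.1 hi)
  obtain ⟨L, hL⟩ := hp i hi'
  obtain ⟨L', hL'⟩ := hq i hi'
  rw [signatureCoeff_eq_of_tendsto hL, signatureCoeff_eq_of_tendsto hL']
  exact hL.mul hL'

/-- **Chen's identity** for signature coefficients of a concatenation `p.trans q`, under
convergence of the dyadic sums of the pieces:
`S_w(p ∗ q) = Σ_{i=0}^{|w|} S_{w.take i}(p) · S_{w.drop i}(q)` (Chen 1957; Friz–Victoir 2010,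
Thm 7.11). [cite: FrizVictoir2010, Thm 7.11] -/
theorem signatureCoeff_trans {p : Path x y} {q : Path y z} {w : List (Fin 2)}
    (hp : ∀ i ≤ w.length, ∃ L, Tendsto (dyadicIterSum (w.take i) (ofPath p)) atTop (𝓝 L))
    (hq : ∀ i ≤ w.length, ∃ L, Tendsto (dyadicIterSum (w.drop i) (ofPath q)) atTop (𝓝 L)) :
    signatureCoeff w (ofPath (p.trans q)) =
      ∑ i ∈ Finset.range (w.length + 1),
        signatureCoeff (w.take i) (ofPath p) * signatureCoeff (w.drop i) (ofPath q) :=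
  signatureCoeff_eq_of_tendsto (tendsto_dyadicIterSum_trans hp hq)

/-- Dyadic increments of a straight segment are all equal to `2⁻ⁿ (b − a)`. [cite: FrizVictoir2010, Example 7.21] -/
lemma dyadicIncr_segment (a b : ℂ) (n i : ℕ) (hi : i < 2 ^ n) :
    dyadicIncr (ofPath (Path.segment a b)) n i = ((2 : ℝ) ^ n)⁻¹ • (b - a) := by
  rw [dyadicIncr_ofPath]
  have h2 : (0 : ℝ) < 2 ^ n := by positivity
  have hi1 : (i : ℝ) + 1 ≤ 2 ^ n := by exact_mod_cast Nat.succ_le_of_lt hi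
  have h1 : ((i : ℝ) + 1) / 2 ^ n ∈ Set.Icc (0 : ℝ) 1 :=
    ⟨by positivity, by rwa [div_le_one h2]⟩
  have h0 : (i : ℝ) / 2 ^ n ∈ Set.Icc (0 : ℝ) 1 :=
    ⟨by positivity, by rw [div_le_one h2]; linarith⟩
  rw [Path.extend_apply _ h1, Path.extend_apply _ h0, Path.segment_apply, Path.segment_apply]
  simp only [AffineMap.lineMap_apply_module']
  rw [add_sub_add_right_eq_sub, ← sub_smul, div_sub_div_same, add_sub_cancel_left, one_div]

/-- The dyadic increments of a straight segment: `2ⁿ` copies of `2⁻ⁿ (b − a)`. [cite: FrizVictoir2010, Example 7.21] -/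
lemma dyadicIncrList_segment (a b : ℂ) (n : ℕ) :
    dyadicIncrList (ofPath (Path.segment a b)) n = List.replicate (2 ^ n) (((2 : ℝ) ^ n)⁻¹ • (b - a)) := by
  apply List.ext_getElem
  · simp
  · intro i h₁ h₂
    rw [length_dyadicIncrList] at h₁
    simp only [dyadicIncrList, List.getElem_ofFn, List.getElem_replicate]
    exact dyadicIncr_segment a b n i h₁

/-- The dyadic iterated sums of a straight segment in closed form:
`C(2ⁿ, m) · 2^{-nm} · Π_j coord w_j (b − a)` (Friz–Victoir 2010, Example 7.21, before the limit). [cite: FrizVictoir2010, Example 7.21] -/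
theorem dyadicIterSum_segment (w : List (Fin 2)) (a b : ℂ) (n : ℕ) :
    dyadicIterSum w (ofPath (Path.segment a b)) n =
      ((2 ^ n).choose w.length : ℝ) * ((2 : ℝ) ^ n)⁻¹ ^ w.length *
        (w.map fun c => coord c (b - a)).prod := by
  rw [dyadicIterSum_eq_iterSum, dyadicIncrList_segment, iterSum_replicate]
  have h : (w.map fun c => coord c (((2 : ℝ) ^ n)⁻¹ • (b - a))) =
      w.map fun c => ((2 : ℝ) ^ n)⁻¹ * coord c (b - a) := by
    simp only [coord_smul]
  rw [h, List.prod_map_mul, List.map_const', List.prod_replicate]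
  ring

/-- Dyadic increments of the constant path vanish. [folklore] -/
lemma dyadicIncrList_refl (a : ℂ) (n : ℕ) :
    dyadicIncrList (ofPath (Path.refl a)) n = List.replicate (2 ^ n) 0 :=
  dyadicIncrList_const a n

/-- The dyadic iterated sums of the constant path: `1` for the empty word, `0` otherwise. [cite: FrizVictoir2010, Def 7.2] -/
theorem dyadicIterSum_refl (w : List (Fin 2)) (a : ℂ) (n : ℕ) :
    dyadicIterSum w (ofPath (Path.refl a)) n = if w = [] then 1 else 0 :=
  dyadicIterSum_const w a n

end Paths

/-! ### The limit for segments and polylines -/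

/-- `C(2ⁿ, m) · (2ⁿ)^{-m} → 1/m!` as `n → ∞` (the volume of the simplex; Friz–Victoir 2010,
Example 7.21: `∫_{0<r₁<⋯<r_m<1} dr = 1/m!`). [cite: FrizVictoir2010, Example 7.21] -/
theorem tendsto_choose_mul_inv_pow (m : ℕ) :
    Tendsto (fun n : ℕ => ((2 ^ n).choose m : ℝ) * ((2 : ℝ) ^ n)⁻¹ ^ m) atTop
      (𝓝 (m.factorial : ℝ)⁻¹) := by
  have hM : Tendsto (fun n : ℕ => (2 : ℝ) ^ n) atTop atTop :=
    tendsto_pow_atTop_atTop_of_one_lt one_lt_two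
  have hfac : ∀ i : ℕ, Tendsto (fun n : ℕ => 1 - (i : ℝ) / (2 : ℝ) ^ n) atTop (𝓝 1) := by
    intro i
    have h := (tendsto_const_nhds (x := (i : ℝ))).div_atTop hM
    simpa using (tendsto_const_nhds (x := (1 : ℝ))).sub h
  have hprod : Tendsto (fun n : ℕ => ∏ i ∈ Finset.range m, (1 - (i : ℝ) / (2 : ℝ) ^ n)) atTop
      (𝓝 1) := by
    have h := tendsto_finsetProd (Finset.range m) (fun i _ => hfac i)
    simpa using h
  have key : ∀ᶠ n : ℕ in atTop, (m.factorial : ℝ)⁻¹ * ∏ i ∈ Finset.range m,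
      (1 - (i : ℝ) / (2 : ℝ) ^ n) = ((2 ^ n).choose m : ℝ) * ((2 : ℝ) ^ n)⁻¹ ^ m := by
    filter_upwards [eventually_ge_atTop m] with n hn
    have hmn : m ≤ 2 ^ n := hn.trans Nat.lt_two_pow_self.le
    have h2 : (2 : ℝ) ^ n ≠ 0 := by positivity
    have hc : ((2 ^ n).choose m : ℝ) = ((2 ^ n).descFactorial m : ℝ) * (m.factorial : ℝ)⁻¹ := by
      rw [Nat.descFactorial_eq_factorial_mul_choose, Nat.cast_mul]
      field_simp
    rw [hc, Nat.descFactorial_eq_prod_range, Nat.cast_prod, ← Finset.card_range m,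
      ← Finset.prod_const, Finset.card_range, mul_comm _ (m.factorial : ℝ)⁻¹, mul_assoc,
      ← Finset.prod_mul_distrib]
    congr 1
    refine Finset.prod_congr rfl fun i hi => ?_
    have him : i ≤ 2 ^ n := ((Finset.mem_range.1 hi).le.trans hmn)
    rw [Nat.cast_sub him, Nat.cast_pow, Nat.cast_ofNat]
    field_simp
  refine Tendsto.congr' key ?_
  simpa using hprod.const_mul ((m.factorial : ℝ)⁻¹)

/-- The signature coefficient of a straight segment with increment `v`:
`Π_j coord w_j v / |w|!`, the word-`w` coefficient of the tensor exponential `exp(v)`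
(Friz–Victoir 2010, Example 7.21). [cite: FrizVictoir2010, Example 7.21] -/
noncomputable def segmentSig (w : List (Fin 2)) (v : ℂ) : ℝ :=
  (w.map fun c => coord c v).prod / (w.length.factorial : ℝ)

/-- Unfolding `segmentSig`. [cite: FrizVictoir2010, Example 7.21] -/
lemma segmentSig_def (w : List (Fin 2)) (v : ℂ) :
    segmentSig w v = (w.map fun c => coord c v).prod / (w.length.factorial : ℝ) := rfl

/-- The empty word has segment signature `1`. [cite: FrizVictoir2010, Example 7.21] -/
@[simp] lemma segmentSig_nil (v : ℂ) : segmentSig [] v = 1 := by simp [segmentSig]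

/-- **The signature of a straight segment is the tensor exponential**: the dyadic iterated sums of
`Path.segment a b` converge to `Π_j coord w_j (b − a) / |w|!` (Friz–Victoir 2010, Example 7.21). [cite: FrizVictoir2010, Example 7.21] -/
theorem tendsto_dyadicIterSum_segment (w : List (Fin 2)) (a b : ℂ) :
    Tendsto (dyadicIterSum w (ofPath (Path.segment a b))) atTop (𝓝 (segmentSig w (b - a))) := by
  have h : dyadicIterSum w (ofPath (Path.segment a b)) = fun n =>
      ((2 ^ n).choose w.length : ℝ) * ((2 : ℝ) ^ n)⁻¹ ^ w.length *
        (w.map fun c => coord c (b - a)).prod :=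
    funext (dyadicIterSum_segment w a b)
  rw [h, segmentSig_def, div_eq_inv_mul]
  exact (tendsto_choose_mul_inv_pow w.length).mul_const _

/-- `S_w(segment a b) = Π_j coord w_j (b − a) / |w|!` (Friz–Victoir 2010, Example 7.21). [cite: FrizVictoir2010, Example 7.21] -/
theorem signatureCoeff_segment (w : List (Fin 2)) (a b : ℂ) :
    signatureCoeff w (ofPath (Path.segment a b)) = segmentSig w (b - a) :=
  signatureCoeff_eq_of_tendsto (tendsto_dyadicIterSum_segment w a b)

/-- The signature coefficients of the polyline through a list of points, as the finite
**tensor-exponential (lattice) formula** `e^{z₁−z₀} ⊗ e^{z₂−z₁} ⊗ ⋯` read in the word `w`: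
`polylineSig w [z₀, z₁, z₂, …] = Σ_{i} segmentSig (w.take i) (z₁ − z₀) · polylineSig (w.drop i) [z₁, z₂, …]`,
with `polylineSig w [] = polylineSig w [z] = [w = []]` (constant curves). Unrolled, this is the sum
over weakly increasing assignments of the letters of `w` to the steps, weighted by `1/r!` for each
run of `r` letters on the same step (Friz–Victoir 2010, §7.4: the signature of a piecewise linear
path is `e^{v₁} ⊗ ⋯ ⊗ e^{v_m}`). [cite: FrizVictoir2010, Thm 7.11] -/
noncomputable def polylineSig : List (Fin 2) → List ℂ → ℝ
  | w, [] => if w = [] then 1 else 0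
  | w, [_] => if w = [] then 1 else 0
  | w, a :: b :: l =>
      ∑ i ∈ Finset.range (w.length + 1), segmentSig (w.take i) (b - a) * polylineSig (w.drop i) (b :: l)

/-- `polylineSig` of the empty list (junk constant curve `0`). [cite: FrizVictoir2010, Thm 7.11] -/
@[simp] lemma polylineSig_nil (w : List (Fin 2)) : polylineSig w [] = if w = [] then 1 else 0 := by
  rw [polylineSig]

/-- `polylineSig` of a single point (constant curve). [cite: FrizVictoir2010, Thm 7.11] -/
@[simp] lemma polylineSig_singleton (w : List (Fin 2)) (a : ℂ) :
    polylineSig w [a] = if w = [] then 1 else 0 := by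
  rw [polylineSig]

/-- The Chen recursion of `polylineSig`. [cite: FrizVictoir2010, Thm 7.11] -/
lemma polylineSig_cons_cons (w : List (Fin 2)) (a b : ℂ) (l : List ℂ) :
    polylineSig w (a :: b :: l) = ∑ i ∈ Finset.range (w.length + 1),
      segmentSig (w.take i) (b - a) * polylineSig (w.drop i) (b :: l) := by
  rw [polylineSig]

/-- The empty word always has `polylineSig = 1`. [cite: FrizVictoir2010, Thm 7.11] -/
@[simp] lemma polylineSig_nil_left (l : List ℂ) : polylineSig [] l = 1 := by
  induction l with
  | nil => simp
  | cons a l ih =>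
    cases l with
    | nil => simp
    | cons b l => rw [polylineSig_cons_cons]; simp [ih]

open Literature.Probability.LatticeModels in
/-- **Main theorem (paths)**: the dyadic iterated sums of the polyline `polylineFrom a l` CONVERGE,
to the tensor-exponential formula `polylineSig w (a :: l)` (Friz–Victoir 2010, Example 7.21 +
Thm 7.11 + §7.4; exact here because `polylineFrom` concatenates with `Path.trans`, whose break
points are dyadic). [cite: FrizVictoir2010, Thm 7.11] -/
theorem tendsto_dyadicIterSum_polylineFrom (a : ℂ) (l : List ℂ) (w : List (Fin 2)) :
    Tendsto (dyadicIterSum w (ofPath (polylineFrom a l).2)) atTop (𝓝 (polylineSig w (a :: l))) := by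
  induction l generalizing a w with
  | nil =>
    have h : dyadicIterSum w (ofPath (polylineFrom a []).2) = fun _ => if w = [] then 1 else 0 :=
      funext (dyadicIterSum_refl w a)
    rw [h, polylineSig_singleton]
    exact tendsto_const_nhds
  | cons b l ih =>
    change Tendsto (dyadicIterSum w (ofPath ((Path.segment a b).trans (polylineFrom b l).2)))
      atTop (𝓝 (polylineSig w (a :: b :: l)))
    rw [← tendsto_add_atTop_iff_nat 1, polylineSig_cons_cons]
    simp only [dyadicIterSum_trans_succ]
    exact tendsto_finsetSum _ fun i _ =>
      (tendsto_dyadicIterSum_segment (w.take i) a b).mul (ih b (w.drop i))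

open Literature.Probability.LatticeModels in
/-- **Main theorem (polylines)**: for the polyline through any list of points the dyadic iterated
sums converge to `polylineSig` (Friz–Victoir 2010, §7.4). [cite: FrizVictoir2010, Thm 7.11] -/
theorem tendsto_dyadicIterSum_polyline (l : List ℂ) (w : List (Fin 2)) :
    Tendsto (dyadicIterSum w ⟨polyline l⟩) atTop (𝓝 (polylineSig w l)) := by
  cases l with
  | nil =>
    have h : dyadicIterSum w (⟨polyline ([] : List ℂ)⟩ : Curve ℂ) = fun _ => if w = [] then 1 else 0 :=
      funext (dyadicIterSum_const w 0)
    rw [h, polylineSig_nil]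
    exact tendsto_const_nhds
  | cons a l => exact tendsto_dyadicIterSum_polylineFrom a l w

open Literature.Probability.LatticeModels in
/-- **Signature coefficients of a polyline = the lattice formula** `polylineSig`
(Friz–Victoir 2010, §7.4: `S(polyline) = e^{v₁} ⊗ ⋯ ⊗ e^{v_m}`). [cite: FrizVictoir2010, Thm 7.11] -/
theorem signatureCoeff_polyline (l : List ℂ) (w : List (Fin 2)) :
    signatureCoeff w ⟨polyline l⟩ = polylineSig w l :=
  signatureCoeff_eq_of_tendsto (tendsto_dyadicIterSum_polyline l w)

/-- **Signature coefficients of a lattice walk**: for the curve `SimpleGraph.Walk.toCurve emb p` of a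
walk (the polyline through its embedded support, as in the SAW / interface items) the dyadic sums
converge and `S_w = polylineSig w (p.support.map emb)` (Friz–Victoir 2010, §7.4). [cite: FrizVictoir2010, Thm 7.11] -/
theorem signatureCoeff_toCurve {V : Type*} {G : SimpleGraph V} {u v : V} (emb : V → ℂ)
    (p : G.Walk u v) (w : List (Fin 2)) :
    signatureCoeff w ⟨p.toCurve emb⟩ = polylineSig w (p.support.map emb) :=
  signatureCoeff_polyline _ _

/-- Convergence of the dyadic sums for the curve of a lattice walk. [cite: FrizVictoir2010, Thm 7.11] -/
theorem tendsto_dyadicIterSum_toCurve {V : Type*} {G : SimpleGraph V} {u v : V} (emb : V → ℂ)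
    (p : G.Walk u v) (w : List (Fin 2)) :
    Tendsto (dyadicIterSum w ⟨p.toCurve emb⟩) atTop (𝓝 (polylineSig w (p.support.map emb))) :=
  tendsto_dyadicIterSum_polyline _ _

end Curve

end Literature.Probability.RandomPlanarGeometry
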